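import Literature.NumberTheory.LFunctions.KadiriExplicitTerms
import Literature.NumberTheory.LFunctions.KadiriDigammaIntegral
import Literature.NumberTheory.LFunctions.ZetaZeroFreeRegionExplicit
import HarnessLib

/-!
# Emptiness of the strip `1 − 1/(r log γ) ≤ β ≤ 1 − 1/(R log γ)`, `γ > T₀`, from Kadiri's master inequality (Mossinghoff–Trudgian 2015 (2.2), refined)

Topic `Literature/NumberTheory/LFunctions`. Everything in this file is PROVED (no named fact); one
abbreviating definition (`mtyLaplaceMoment`, the first moment `D(X) = ∫₀^{d₁} u h(u)e^{−Xu}du` of the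
kernel). This is the last analytic step of the tree's discharge of the large-height part of
Mossinghoff–Trudgian–Yang's zero-free region (`zero_free_region_mossinghoff_trudgian_yang_large_height`):

* **Part A** (real analysis of the kernel): increment bounds
  `(X₂−X₁)D(X₂) ≤ L(X₁) − L(X₂) ≤ (X₂−X₁)D(X₁)` for `L = mtyLaplace θ`, hence for
  `K(w) = b₁L(1−w) − b₀L(−w)` (Kadiri's `K(w, θ)`, `kadiriK_eq`) the one-sided Lipschitz bound
  `K(w₂) − K(w₁) ≤ (w₂ − w₁)[b₁D(1−w₂) − b₀D(−w₁)]`, and the geometry of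
  `w = r log γ₀/(R log(nγ₀ + t₀))`: `w₀ ≤ w < r/R`, `r/R − w ≤ (r/R) log(n+1) · rη`;
* **Part B** (the per-zero inequality): `master_explicit` with `η = 1/(r log γ₀)`,
  `σ = 1 − 1/(R log(nγ₀+t₀))`, the third-order real-axis bounds `|L(X) − g₁/X| ≤ m/X³` and Part A
  give `K(r/R) − η·Q(η) ≤ g₁(1−κ)A/(2r)` with an explicit `Q`, non-decreasing in `η`;
* **Part C** (the contradiction): if `Q(η₀) ≤ 0` and `g₁(1−κ)A/2 < r·K(r/R)` (two real
  inequalities between explicit constants, verified numerically elsewhere) then no zero lies in the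
  strip: `KadiriStripEmpty T₀ r R`, given the region `R` at all heights, the numerical verification of
  RH up to a height `H ≥ t₀` (hypothesis), and Kadiri's side conditions on `κ, δ`.

The refinement over Mossinghoff–Trudgian's (3.1) (two branches `η ≤ η₁`, `η₁ ≤ η ≤ η₀`) is that the
favourable linear term of `C(η)` is played against the Lipschitz loss of `K(w(η))` directly, so that
the infimum of `K(w) − C(η)` over the strip is its limit `K(r/R)` as `η → 0`.

## References

* H. Kadiri, Acta Arith. 117 (2005) = arXiv:math/0401238, (1.5), (2.2), §3. (`Kadiri2005`)
* M. J. Mossinghoff, T. S. Trudgian, J. Number Theory 157 (2015) = arXiv:1410.3926, (2.2), (3.1),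
  §4. (`MossinghoffTrudgian2015`)
* M. J. Mossinghoff, T. S. Trudgian, A. Yang, arXiv:2212.06867, §9. (`MossinghoffTrudgianYangRNT2024`)
-/

noncomputable section

open Complex Real MeasureTheory Set Filter

namespace Literature.NumberTheory.LFunctions

/-- The first moment of the kernel against `e^{−Xu}`: `D(X) = ∫₀^{d₁} u h(u) e^{−Xu} du`
(`= −L'(X)`). [cite: Kadiri2005, §3] -/
def mtyLaplaceMoment (θ X : ℝ) : ℝ :=
  ∫ u in (0 : ℝ)..mtyD1 θ, u * mtyH1 1 θ u * Real.exp (-(X * u))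

namespace KadiriStrip

variable {θ : ℝ}

/-! ## Part A: increments of `L` and of `K` -/

/-- `e^{−X₁u} − e^{−X₂u} ≥ (X₂ − X₁) u e^{−X₂u}` (convexity of `exp`). [folklore] -/
theorem exp_sub_exp_ge (X₁ X₂ u : ℝ) :
    (X₂ - X₁) * u * Real.exp (-(X₂ * u)) ≤ Real.exp (-(X₁ * u)) - Real.exp (-(X₂ * u)) := by
  have h := Real.add_one_le_exp ((X₂ - X₁) * u)
  have e : Real.exp (-(X₁ * u)) = Real.exp (-(X₂ * u)) * Real.exp ((X₂ - X₁) * u) := by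
    rw [← Real.exp_add]; ring_nf
  rw [e]
  nlinarith [Real.exp_pos (-(X₂ * u))]

/-- `e^{−X₁u} − e^{−X₂u} ≤ (X₂ − X₁) u e^{−X₁u}` (convexity of `exp`). [folklore] -/
theorem exp_sub_exp_le (X₁ X₂ u : ℝ) :
    Real.exp (-(X₁ * u)) - Real.exp (-(X₂ * u)) ≤ (X₂ - X₁) * u * Real.exp (-(X₁ * u)) := by
  have h := Real.add_one_le_exp (-((X₂ - X₁) * u))
  have e : Real.exp (-(X₂ * u)) = Real.exp (-(X₁ * u)) * Real.exp (-((X₂ - X₁) * u)) := by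
    rw [← Real.exp_add]; ring_nf
  rw [e]
  nlinarith [Real.exp_pos (-(X₁ * u))]

/-- **Increment bounds for `L`**: `(X₂−X₁)D(X₂) ≤ L(X₁) − L(X₂) ≤ (X₂−X₁)D(X₁)` (any `X₁, X₂`;
convexity of `exp` and `h ≥ 0`). [folklore] -/
theorem mtyLaplace_sub_bounds (hθ : 0 < θ) (hθ' : θ < π / 2) (X₁ X₂ : ℝ) :
    (X₂ - X₁) * mtyLaplaceMoment θ X₂ ≤ mtyLaplace θ X₁ - mtyLaplace θ X₂ ∧
      mtyLaplace θ X₁ - mtyLaplace θ X₂ ≤ (X₂ - X₁) * mtyLaplaceMoment θ X₁ := by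
  have hD := KadiriTest.mtyD1_pos hθ hθ'
  have hc : ∀ X : ℝ, Continuous fun u : ℝ ↦ mtyH1 1 θ u * Real.exp (-(X * u)) := fun X ↦ by
    have := continuous_mtyH1 1 θ; fun_prop
  have hc' : ∀ X : ℝ, Continuous fun u : ℝ ↦ u * mtyH1 1 θ u * Real.exp (-(X * u)) := fun X ↦ by
    have := continuous_mtyH1 1 θ; fun_prop
  have hsub : mtyLaplace θ X₁ - mtyLaplace θ X₂ =
      ∫ u in (0 : ℝ)..mtyD1 θ, mtyH1 1 θ u * (Real.exp (-(X₁ * u)) - Real.exp (-(X₂ * u))) := by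
    unfold mtyLaplace
    rw [← intervalIntegral.integral_sub ((hc X₁).intervalIntegrable _ _) ((hc X₂).intervalIntegrable _ _)]
    refine intervalIntegral.integral_congr fun u _ ↦ ?_
    ring
  have hmom : ∀ X : ℝ, (X₂ - X₁) * mtyLaplaceMoment θ X =
      ∫ u in (0 : ℝ)..mtyD1 θ, mtyH1 1 θ u * ((X₂ - X₁) * u * Real.exp (-(X * u))) := by
    intro X
    unfold mtyLaplaceMoment
    rw [← intervalIntegral.integral_const_mul]
    refine intervalIntegral.integral_congr fun u _ ↦ ?_
    ring
  constructor
  · rw [hsub, hmom X₂]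
    refine intervalIntegral.integral_mono_on hD.le ?_ ?_ fun u hu ↦ ?_
    · exact ((continuous_mtyH1 1 θ).mul (by fun_prop)).intervalIntegrable _ _
    · exact ((continuous_mtyH1 1 θ).mul (by fun_prop)).intervalIntegrable _ _
    · exact mul_le_mul_of_nonneg_left (exp_sub_exp_ge X₁ X₂ u) (mtyH1_one_nonneg hθ hθ' hu.1 hu.2)
  · rw [hsub, hmom X₁]
    refine intervalIntegral.integral_mono_on hD.le ?_ ?_ fun u hu ↦ ?_
    · exact ((continuous_mtyH1 1 θ).mul (by fun_prop)).intervalIntegrable _ _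
    · exact ((continuous_mtyH1 1 θ).mul (by fun_prop)).intervalIntegrable _ _
    · exact mul_le_mul_of_nonneg_left (exp_sub_exp_le X₁ X₂ u) (mtyH1_one_nonneg hθ hθ' hu.1 hu.2)

/-- `D ≥ 0`. [folklore] -/
theorem mtyLaplaceMoment_nonneg (hθ : 0 < θ) (hθ' : θ < π / 2) (X : ℝ) : 0 ≤ mtyLaplaceMoment θ X := by
  unfold mtyLaplaceMoment
  have hD := KadiriTest.mtyD1_pos hθ hθ'
  refine intervalIntegral.integral_nonneg hD.le fun u hu ↦ ?_
  exact mul_nonneg (mul_nonneg hu.1 (mtyH1_one_nonneg hθ hθ' hu.1 hu.2)) (Real.exp_nonneg _)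

/-- `D` is non-increasing. [folklore] -/
theorem mtyLaplaceMoment_antitone (hθ : 0 < θ) (hθ' : θ < π / 2) : Antitone (mtyLaplaceMoment θ) := by
  intro X Y hXY
  have hD := KadiriTest.mtyD1_pos hθ hθ'
  unfold mtyLaplaceMoment
  refine intervalIntegral.integral_mono_on hD.le ?_ ?_ fun u hu ↦ ?_
  · exact ((continuous_id.mul (continuous_mtyH1 1 θ)).mul (by fun_prop)).intervalIntegrable _ _
  · exact ((continuous_id.mul (continuous_mtyH1 1 θ)).mul (by fun_prop)).intervalIntegrable _ _
  · refine mul_le_mul_of_nonneg_left (Real.exp_le_exp.2 (by nlinarith [hu.1]))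
      (mul_nonneg hu.1 (mtyH1_one_nonneg hθ hθ' hu.1 hu.2))

/-- **One-sided Lipschitz bound for `K(w) = b₁L(1−w) − b₀L(−w)`**: for `b₀, b₁ ≥ 0` (any `w₁, w₂`), `K(w₂) − K(w₁) ≤ (w₂ − w₁)[b₁D(1−w₂) − b₀D(−w₁)]` (the two increments of `L` bounded
on opposite sides; no differentiation). [cite: MossinghoffTrudgian2015, (2.2)] -/
theorem kadiriK_sub_le (hθ : 0 < θ) (hθ' : θ < π / 2) {b₀ b₁ : ℝ} (hb₀ : 0 ≤ b₀) (hb₁ : 0 ≤ b₁)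
    (w₁ w₂ : ℝ) :
    (b₁ * mtyLaplace θ (1 - w₂) - b₀ * mtyLaplace θ (-w₂)) -
        (b₁ * mtyLaplace θ (1 - w₁) - b₀ * mtyLaplace θ (-w₁)) ≤
      (w₂ - w₁) * (b₁ * mtyLaplaceMoment θ (1 - w₂) - b₀ * mtyLaplaceMoment θ (-w₁)) := by
  -- `L(1−w₂) − L(1−w₁) ≤ (w₂−w₁) D(1−w₂)` (upper increment with `X₁ = 1−w₂ ≤ X₂ = 1−w₁`)
  have h1 := (mtyLaplace_sub_bounds hθ hθ' (1 - w₂) (1 - w₁)).2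
  -- `L(−w₂) − L(−w₁) ≥ (w₂−w₁) D(−w₁)` (lower increment with `X₁ = −w₂ ≤ X₂ = −w₁`)
  have h2 := (mtyLaplace_sub_bounds hθ hθ' (-w₂) (-w₁)).1
  have e1 : (1 - w₁ - (1 - w₂)) = w₂ - w₁ := by ring
  have e2 : (-w₁ - -w₂) = w₂ - w₁ := by ring
  rw [e1] at h1
  rw [e2] at h2
  nlinarith [mul_le_mul_of_nonneg_left h1 hb₁, mul_le_mul_of_nonneg_left h2 hb₀]

/-! ## Part A': the geometry of `w = r log γ₀ /(R log(nγ₀ + t₀))` -/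

/-- `w < r/R`. [cite: MossinghoffTrudgian2015, §2] -/
theorem w_lt {r R n t₀ γ₀ : ℝ} (hr : 0 < r) (hR : 0 < R) (hn : 1 ≤ n) (ht₀ : 0 < t₀) (hγ : 1 < γ₀) :
    r * Real.log γ₀ / (R * Real.log (n * γ₀ + t₀)) < r / R := by
  have hlogγ : 0 < Real.log γ₀ := Real.log_pos hγ
  have hlt : Real.log γ₀ < Real.log (n * γ₀ + t₀) := Real.log_lt_log (by linarith) (by nlinarith)
  have hlogG : 0 < Real.log (n * γ₀ + t₀) := hlogγ.trans hlt
  rw [div_lt_div_iff₀ (by positivity) hR]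
  nlinarith [mul_pos hr hR]

/-- `r/R − w ≤ (r/R) · log(n+1)/log γ₀` for `γ₀ ≥ t₀`, `γ₀ > 1`. [cite: MossinghoffTrudgian2015, §2] -/
theorem sub_w_le {r R n t₀ γ₀ : ℝ} (hr : 0 < r) (hR : 0 < R) (hn : 1 ≤ n) (ht₀ : 0 < t₀) (hγ : 1 < γ₀)
    (hγt : t₀ ≤ γ₀) :
    r / R - r * Real.log γ₀ / (R * Real.log (n * γ₀ + t₀)) ≤ r / R * (Real.log (n + 1) / Real.log γ₀) := by
  have hlogγ : 0 < Real.log γ₀ := Real.log_pos hγ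
  have hlt : Real.log γ₀ < Real.log (n * γ₀ + t₀) := Real.log_lt_log (by linarith) (by nlinarith)
  have hlogG : 0 < Real.log (n * γ₀ + t₀) := hlogγ.trans hlt
  -- `log(nγ₀ + t₀) ≤ log γ₀ + log(n+1)`
  have hup : Real.log (n * γ₀ + t₀) ≤ Real.log γ₀ + Real.log (n + 1) := by
    rw [← Real.log_mul (by linarith) (by linarith)]
    exact Real.log_le_log (by nlinarith) (by nlinarith)
  have e : r / R - r * Real.log γ₀ / (R * Real.log (n * γ₀ + t₀)) =
      r / R * ((Real.log (n * γ₀ + t₀) - Real.log γ₀) / Real.log (n * γ₀ + t₀)) := by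
    field_simp
  rw [e]
  refine mul_le_mul_of_nonneg_left ?_ (by positivity)
  rw [div_le_div_iff₀ hlogG hlogγ]
  have h1 : (Real.log (n * γ₀ + t₀) - Real.log γ₀) ≤ Real.log (n + 1) := by linarith
  have h0 : 0 ≤ Real.log (n + 1) := Real.log_nonneg (by linarith)
  nlinarith [mul_le_mul_of_nonneg_left hlt.le h0]

/-! ## The coefficients of the error polynomial `η·(q₀ + q₁η + q₂η²)` -/

/-- The `η`-coefficient `q₀` of the error polynomial of the method (Mossinghoff–Trudgian's
`C₁ + p₁ + q₁` terms with the tree's constants): the `Γ`-terms (Kadiri Lemma 4.5), the linearised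
`L`-values of the kept pair and of the pole at `k = 0`, and the `1/t₀`-part of the far-zero tails.
[cite: MossinghoffTrudgian2015, §4] -/
def coeffQ0 (θ : ℝ) (K : ℕ) (b : ℕ → ℝ) (r δ κ σ₀ η₀ T₀ t₀ Mst : ℝ) : ℝ :=
  -(b 1) * fordSmoothW0 θ + κ * b 1 * fordSmoothW0 θ * (1 / δ + 1 / (σ₀ + δ - η₀)) -
      κ * b 0 * fordSmoothW0 θ / δ +
    b 0 * fordSmoothW0 θ * (-((1 - κ) / 2) * Real.log π + (Complex.digamma ((3 / 2 : ℝ) : ℂ)).re / 2 -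
      κ / 2 * (Complex.digamma ((((σ₀ + δ) / 2 + 1 : ℝ)) : ℂ)).re) +
    ∑ k ∈ Finset.range K, b (k + 1) *
      (fordSmoothW0 θ * ((1 - κ) / 2 * (Real.log ((k + 1 : ℕ) : ℝ) - Real.log (2 * π)) + 5 / T₀ ^ 2) +
        (1 + κ) * fordSmoothW0 θ / T₀ ^ 2 + (1 + κ) * Mst * 90 * (1 / t₀ ^ 2 + 1 / t₀) / r)

/-- The `η²`-coefficient `q₁` (pole terms at `k ≥ 1`, the `1/(rη)`-part of the `Γ`-remainders, the
far-zero tails). [cite: MossinghoffTrudgian2015, §4] -/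
def coeffQ1 (K : ℕ) (b : ℕ → ℝ) (r κ σ₀ T₀ t₀ Mst m : ℝ) : ℝ :=
  b 0 * ((1 + κ) * Mst * (3 * KadiriTail.tailBound 0 t₀)) +
    ∑ k ∈ Finset.range K, b (k + 1) *
      ((1 + κ) * Mst / T₀ ^ 2 + (1 + κ) * m * (π / (σ₀ - 1 / 2)) / (2 * π * (σ₀ - 1 / 2) * r) +
        (1 + κ) * Mst * (3 * ((154 + 30 * (Real.log ((k + 1 : ℕ) : ℝ) + 1)) * (1 / t₀ ^ 2 + 1 / t₀) +
          30 * (Real.log t₀ / t₀ ^ 2 + (Real.log t₀ + 1) / t₀))))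

/-- The `η³`-coefficient `q₂` (third-order terms of the linearised `L`-values and the
`Γ`-remainders with the crude `J`-bounds). [cite: MossinghoffTrudgian2015, §4] -/
def coeffQ2 (K : ℕ) (b : ℕ → ℝ) (δ κ σ₀ η₀ T₀ m : ℝ) : ℝ :=
  (b 1 * m + κ * b 1 * m * (1 / δ ^ 3 + 1 / (σ₀ + δ - η₀) ^ 3) + κ * b 0 * m / (σ₀ + δ - 1) ^ 3 +
      b 0 * ((1 + κ) * m * (1 / σ₀ ^ 3 + (π / (σ₀ - 1 / 2) * (Real.log 3 + 12) +
        (4 / (σ₀ - 1 / 2) ^ 2 + 8)) / (2 * π * (σ₀ - 1 / 2))))) +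
    ∑ k ∈ Finset.range K, b (k + 1) * ((1 + κ) * m * (2 / T₀ ^ 2 +
      (π / (σ₀ - 1 / 2) * Real.log ((k + 1 : ℕ) : ℝ) +
        (π / (σ₀ - 1 / 2) * (12 + Real.log 2) + (4 / (σ₀ - 1 / 2) ^ 2 + 8))) / (2 * π * (σ₀ - 1 / 2))))

/-! ## Part B: the per-zero contradiction -/

set_option maxHeartbeats 8000000 in
/-- **The per-zero contradiction.** Fix the parameters of the method and a height `γ₀ ≥ T₀`
(`T₀ ≥ max(7, t₀)`), put `η = 1/(r log γ₀)`, `σ = 1 − 1/(R log(Kγ₀ + t₀))`,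
`σ₀ ≤ 1 − 1/(R log(KT₀ + t₀))`, `η₀ ≥ 1/(r log T₀)`, `w₀ ≤ r log T₀/(R log(KT₀+t₀))` (one-sided, so that
decimal values can be used). Suppose the
hypotheses of `KadiriExplicit.master_explicit` hold at this `σ, η` for a zero `ρ₀` with
`Im ρ₀ = γ₀`, `1 − η ≤ Re ρ₀ ≤ σ`, and the two numerical conditions

* (N1) `q₀ + λ₀ r² log(K+1)/R + q₁ η₀ + q₂ η₀² ≤ 0` (the coefficients `q₀, q₁, q₂` written out in the
  statement; `λ₀ ≥ b₁D(1 − r/R) − b₀D(−w₀)`, `λ₀ ≥ 0`),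
* (N2) `g₁(1−κ)A/(2r) < b₁L(1 − r/R) − b₀L(−r/R)` (`A = Σ_{k=1}^{K} b_k`).

Then `False`. [cite: MossinghoffTrudgian2015, (2.2)] -/
theorem per_zero_contra (hθ : 0 < θ) (hθ' : θ < π / 2) {r R δ κ γ₀ t₀ T₀ Mst m lam0 : ℝ} {K : ℕ}
    {b : ℕ → ℝ} (hb : IsNonnegTrigPoly K b) (hK : 1 ≤ K) (hr : 0 < r) (hR : 0 < R)
    (hδ : 0 ≤ δ) (hδ1 : δ < 1) (hκ0 : 0 ≤ κ) (hκ1 : κ ≤ 1) (hT₀ : 7 ≤ T₀) (ht₀ : 4 ≤ t₀)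
    (ht₀T : t₀ ≤ T₀) (hγ₀ : T₀ ≤ γ₀)
    -- abbreviations (as hypotheses of definitional shape, to keep the statement readable)
    {η σ σ₀ η₀ w₀ : ℝ} (hη : η = 1 / (r * Real.log γ₀))
    (hσ : σ = 1 - 1 / (R * Real.log (K * γ₀ + t₀)))
    (hσ₀ : σ₀ ≤ 1 - 1 / (R * Real.log (K * T₀ + t₀))) (hη₀ : 1 / (r * Real.log T₀) ≤ η₀)
    (hw₀ : w₀ ≤ r * Real.log T₀ / (R * Real.log (K * T₀ + t₀)))
    -- side conditions on the parameters
    (hσ₀half : 1 / 2 < σ₀) (hη₀half : η₀ < 1 / 2) (hδσ₀ : 2 * (1 - σ₀) ≤ δ) (hσ₀δ : 1 < σ₀ + δ)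
    (hκΓ : κ * (σ₀ + 2 + δ) ≤ σ₀ + 2) (hA : κ * (2 * σ₀ - 1 + 2 * δ) ≤ 2 * σ₀ - 1)
    (hSt : κ * (1 + 2 * δ) * (δ + δ ^ 2 + t₀ ^ 2) ≤ (2 * σ₀ - 1) * (t₀ ^ 2 - (1 - σ₀)))
    (hMst : mtyM θ (-(r / R)) ≤ Mst)
    (hm : ∀ u ∈ Icc 0 (mtyD1 θ), |mtyH1Deriv2 1 θ u| ≤ m)
    (hlam0 : 0 ≤ lam0)
    (hlam : b 1 * mtyLaplaceMoment θ (1 - r / R) - b 0 * mtyLaplaceMoment θ (-w₀) ≤ lam0)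
    -- the inputs of the master inequality at this zero
    (hζ : ∀ k ≤ K, riemannZeta ((σ : ℂ) + (((k : ℝ) * γ₀ : ℝ) : ℂ) * Complex.I) ≠ 0)
    (hζ' : ∀ k ≤ K, riemannZeta (((σ + δ : ℝ) : ℂ) + (((k : ℝ) * γ₀ : ℝ) : ℂ) * Complex.I) ≠ 0)
    (hnear : ∀ k ≤ K, ∀ ρ : NicolasJExplicit.Zeros, |(ρ : ℂ).im - (k : ℝ) * γ₀| < t₀ →
      1 - σ ≤ (ρ : ℂ).re ∧ (ρ : ℂ).re ≤ σ)
    (hB : ∀ y : ℝ, κ * ((fordLaplace (kadiriTest θ η) ((δ : ℂ) + y * Complex.I)).re +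
        (fordLaplace (kadiriTest θ η) (((2 * σ - 1 + δ : ℝ) : ℂ) + y * Complex.I)).re) ≤
      (fordLaplace (kadiriTest θ η) (((0 : ℝ) : ℂ) + y * Complex.I)).re +
        (fordLaplace (kadiriTest θ η) (((2 * σ - 1 : ℝ) : ℂ) + y * Complex.I)).re)
    (ρ₀ : NicolasJExplicit.Zeros) (hρ₀ : (ρ₀ : ℂ).im = γ₀) (hβlow : 1 - η ≤ (ρ₀ : ℂ).re)
    (hβσ : (ρ₀ : ℂ).re ≤ σ)
    -- (N1) and (N2)
    (hN1 : coeffQ0 θ K b r δ κ σ₀ η₀ T₀ t₀ Mst + lam0 * (r ^ 2 * Real.log ((K : ℝ) + 1) / R) +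
      coeffQ1 K b r κ σ₀ T₀ t₀ Mst m * η₀ + coeffQ2 K b δ κ σ₀ η₀ T₀ m * η₀ ^ 2 ≤ 0)
    (hN2 : fordSmoothW0 θ * (1 - κ) * (∑ k ∈ Finset.range K, b (k + 1)) / (2 * r) <
      b 1 * mtyLaplace θ (1 - r / R) - b 0 * mtyLaplace θ (-(r / R))) :
    False := by
  have hb0 : ∀ k, 0 ≤ b k := hb.1
  have hKr : (1 : ℝ) ≤ K := by exact_mod_cast hK
  have hγ7 : 7 ≤ γ₀ := hT₀.trans hγ₀
  have hlogγ : 0 < Real.log γ₀ := Real.log_pos (by linarith)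
  have hlogT : 0 < Real.log T₀ := Real.log_pos (by linarith)
  have hlogT' : Real.log T₀ ≤ Real.log γ₀ := Real.log_le_log (by linarith) hγ₀
  have hηpos : 0 < η := by rw [hη]; positivity
  have hηη₀ : η ≤ η₀ := by
    rw [hη]; exact le_trans (one_div_le_one_div_of_le (by positivity) (by nlinarith)) hη₀
  have hη₀pos : 0 < η₀ := hηpos.trans_le hηη₀
  have hη2 : η < 1 / 2 := by linarith
  have hηsq : η ^ 2 ≤ η * η₀ := by nlinarith
  have hηcube : η ^ 3 ≤ η * η₀ ^ 2 := by nlinarith [mul_le_mul hηη₀ hηη₀ hηpos.le hη₀pos.le]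
  have hlogKT : 0 < Real.log (K * T₀ + t₀) := Real.log_pos (by nlinarith)
  have hlogKγ : Real.log (K * T₀ + t₀) ≤ Real.log (K * γ₀ + t₀) :=
    Real.log_le_log (by nlinarith) (by nlinarith)
  have hlogKγ0 : 0 < Real.log (K * γ₀ + t₀) := hlogKT.trans_le hlogKγ
  have hσ₀σ : σ₀ ≤ σ := by
    rw [hσ]
    have := one_div_le_one_div_of_le (by positivity) (mul_le_mul_of_nonneg_left hlogKγ hR.le)
    linarith
  have hσ1 : σ < 1 := by
    have hpos : 0 < 1 / (R * Real.log (K * γ₀ + t₀)) := by positivity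
    rw [hσ]; linarith
  have hσhalf : 1 / 2 < σ := by linarith
  have ha₀ : 0 < σ₀ - 1 / 2 := by linarith
  -- `w` and its geometry
  set w : ℝ := (1 - σ) / η with hwdef
  clear_value w
  have hw : w = r * Real.log γ₀ / (R * Real.log (K * γ₀ + t₀)) := by
    rw [hwdef, hσ, hη]; field_simp; ring
  have hw₀w : w₀ ≤ w := by
    have h := kadiri_w_ge_w0 (n := (K : ℝ)) (t₀ := t₀) (T₀ := T₀) (γ₀ := γ₀) (η := η) hr hR hKr
      (by linarith) (by linarith) hγ₀ hηpos (by rw [hη])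
    refine hw₀.trans (h.trans_eq ?_)
    rw [hwdef, hσ]; ring
  have hwlt : w < r / R := by rw [hw]; exact w_lt hr hR hKr (by linarith) (by linarith)
  have hsubw : r / R - w ≤ r / R * (Real.log (K + 1) / Real.log γ₀) := by
    rw [hw]; exact sub_w_le hr hR hKr (by linarith) (by linarith) (ht₀T.trans hγ₀)
  have hlogγη : Real.log γ₀ = 1 / (r * η) := by rw [hη]; field_simp
  have hrRw : r / R - w ≤ η * (r ^ 2 * Real.log ((K : ℝ) + 1) / R) := by
    refine hsubw.trans_eq ?_
    rw [hlogγη]; field_simp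
  -- the constants of the method
  set g : ℝ := fordSmoothW0 θ with hg
  clear_value g
  have hg0 : 0 < g := by rw [hg]; exact fordSmoothW0_pos hθ hθ'
  have hm0 : 0 ≤ m := (abs_nonneg _).trans (hm 0 ⟨le_rfl, (KadiriTest.mtyD1_pos hθ hθ').le⟩)
  have hMst0 : 0 ≤ Mst := (KadiriTest.mtyM_nonneg hθ hθ' _).trans hMst
  -- the master inequality at this zero
  have hMσ : ∀ x : ℝ, σ - 1 ≤ x → mtyM θ (x / η) ≤ Mst := by
    intro x hx
    refine le_trans (KadiriTest.mtyM_antitone hθ hθ' ?_) hMst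
    -- `−r/R ≤ x/η` from `x/η ≥ (σ−1)/η = −w > −r/R`
    have h1 : (σ - 1) / η ≤ x / η := div_le_div_of_nonneg_right hx hηpos.le
    have h2 : (σ - 1) / η = -w := by rw [hwdef]; ring
    linarith
  have hκσ : κ * (σ - σ₀) ≤ 1 * (σ - σ₀) := mul_le_mul_of_nonneg_right hκ1 (by linarith)
  have hκΓσ : κ * (σ + 2 + δ) ≤ σ + 2 := by linarith
  have hAσ : κ * (2 * σ - 1 + 2 * δ) ≤ 2 * σ - 1 := by linarith
  have hStσ : κ * (2 * σ - 1 + 2 * δ) * (-(1 - σ) + (2 * σ - 1) * δ + δ ^ 2 + t₀ ^ 2) ≤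
      (2 * σ - 1) * (-(1 - σ) + t₀ ^ 2) := by
    have h1 : κ * (2 * σ - 1 + 2 * δ) ≤ κ * (1 + 2 * δ) := mul_le_mul_of_nonneg_left (by linarith) hκ0
    have hδσ : (2 * σ - 1) * δ ≤ 1 * δ := mul_le_mul_of_nonneg_right (by linarith) hδ
    have h2 : -(1 - σ) + (2 * σ - 1) * δ + δ ^ 2 + t₀ ^ 2 ≤ δ + δ ^ 2 + t₀ ^ 2 := by linarith
    have ht16 : 16 ≤ t₀ ^ 2 := by nlinarith
    have hδσ' : 0 ≤ (2 * σ - 1) * δ := mul_nonneg (by linarith) hδ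
    have h3 : 0 ≤ -(1 - σ) + (2 * σ - 1) * δ + δ ^ 2 + t₀ ^ 2 := by nlinarith [sq_nonneg δ]
    have h4 : 0 ≤ κ * (1 + 2 * δ) := by positivity
    have h5 : (2 * σ₀ - 1) * (t₀ ^ 2 - (1 - σ₀)) ≤ (2 * σ - 1) * (-(1 - σ) + t₀ ^ 2) :=
      mul_le_mul (by linarith) (by linarith) (by linarith) (by linarith)
    calc κ * (2 * σ - 1 + 2 * δ) * (-(1 - σ) + (2 * σ - 1) * δ + δ ^ 2 + t₀ ^ 2)
        ≤ κ * (1 + 2 * δ) * (δ + δ ^ 2 + t₀ ^ 2) := mul_le_mul h1 h2 h3 h4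
      _ ≤ _ := hSt.trans h5
  have HM := KadiriExplicit.master_explicit hθ hθ' hηpos (σ₀ := σ₀) (σ := σ) (δ := δ) (κ := κ)
    (γ₀ := γ₀) (t₀ := t₀) (T₀ := T₀) (Mst := Mst) (m := m) hb hK hσ₀half hσ₀σ hσ1 hδ hδ1
    (by linarith) hκ0 hκ1 hκΓσ hT₀ hγ₀ ht₀ hζ hζ' hnear hB hAσ hStσ hMσ hm
    (KadiriDigammaIntegral.J_zero_le ha₀) (fun t ht ↦ KadiriDigammaIntegral.J_le_log ha₀ (by linarith))
    ρ₀ hρ₀ hβlow hβσ hη2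
  -- the `L`-arguments in terms of `w`
  have hηne : η ≠ 0 := hηpos.ne'
  have e1 : (σ - (1 - η)) / η = 1 - w := by rw [hwdef]; field_simp; ring
  have e2 : (σ - 1) / η = -w := by rw [hwdef]; ring
  have e3 : (σ + δ - 1 + (1 - η)) / η = (σ + δ - η) / η := by ring
  rw [e1, e2, e3] at HM
  -- third-order bounds on the four auxiliary `L`-values
  have hX₁ : 0 < 1 / η := by positivity
  have hδpos : 0 < δ := by linarith
  have hX₂ : 0 < δ / η := by positivity
  have hden₃ : 0 < σ₀ + δ - η₀ := by linarith
  have hden₃' : σ₀ + δ - η₀ ≤ σ + δ - η := by linarith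
  have hX₃ : 0 < (σ + δ - η) / η := div_pos (by linarith) hηpos
  have hden₄ : 0 < σ₀ + δ - 1 := by linarith
  have hden₄' : σ₀ + δ - 1 ≤ σ + δ - 1 := by linarith
  have hden₄'' : σ + δ - 1 ≤ δ := by linarith
  have hX₄ : 0 < (σ + δ - 1) / η := div_pos (by linarith) hηpos
  have hL1 := (abs_le.1 (KadiriExplicit.abs_mtyLaplace_sub_le hθ hθ' hX₁ hm)).1
  have hL2 := (abs_le.1 (KadiriExplicit.abs_mtyLaplace_sub_le hθ hθ' hX₂ hm)).2
  have hL3 := (abs_le.1 (KadiriExplicit.abs_mtyLaplace_sub_le hθ hθ' hX₃ hm)).2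
  have hL4 := (abs_le.1 (KadiriExplicit.abs_mtyLaplace_sub_le hθ hθ' hX₄ hm)).1
  -- rewrite the rational functions of `1/η` etc.
  have r1 : fordSmoothW0 θ / (1 / η) = g * η := by rw [hg]; field_simp
  have r1' : m / (1 / η) ^ 3 = m * η ^ 3 := by field_simp
  have r2 : fordSmoothW0 θ / (δ / η) = g * η / δ := by rw [hg]; field_simp
  have r2' : m / (δ / η) ^ 3 = m * η ^ 3 / δ ^ 3 := by field_simp
  have r3 : fordSmoothW0 θ / ((σ + δ - η) / η) = g * η / (σ + δ - η) := by rw [hg]; field_simp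
  have r3' : m / ((σ + δ - η) / η) ^ 3 = m * η ^ 3 / (σ + δ - η) ^ 3 := by field_simp
  have r4 : fordSmoothW0 θ / ((σ + δ - 1) / η) = g * η / (σ + δ - 1) := by rw [hg]; field_simp
  have r4' : m / ((σ + δ - 1) / η) ^ 3 = m * η ^ 3 / (σ + δ - 1) ^ 3 := by field_simp
  rw [r1, r1'] at hL1
  rw [r2, r2'] at hL2
  rw [r3, r3'] at hL3
  rw [r4, r4'] at hL4
  -- monotone replacements in `σ`, `η`
  have hgη : 0 ≤ g * η := by positivity
  have hmη : 0 ≤ m * η ^ 3 := by positivity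
  have hL3' : mtyLaplace θ ((σ + δ - η) / η) ≤ g * η / (σ₀ + δ - η₀) + m * η ^ 3 / (σ₀ + δ - η₀) ^ 3 := by
    have h1 : g * η / (σ + δ - η) ≤ g * η / (σ₀ + δ - η₀) :=
      div_le_div_of_nonneg_left hgη hden₃ hden₃'
    have h2 : m * η ^ 3 / (σ + δ - η) ^ 3 ≤ m * η ^ 3 / (σ₀ + δ - η₀) ^ 3 :=
      div_le_div_of_nonneg_left hmη (by positivity) (pow_le_pow_left₀ hden₃.le hden₃' 3)
    linarith
  have hL4' : g * η / δ - m * η ^ 3 / (σ₀ + δ - 1) ^ 3 ≤ mtyLaplace θ ((σ + δ - 1) / η) := by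
    have h1 : g * η / δ ≤ g * η / (σ + δ - 1) :=
      div_le_div_of_nonneg_left hgη (by linarith) hden₄''
    have h2 : m * η ^ 3 / (σ + δ - 1) ^ 3 ≤ m * η ^ 3 / (σ₀ + δ - 1) ^ 3 :=
      div_le_div_of_nonneg_left hmη (by positivity) (pow_le_pow_left₀ hden₄.le hden₄' 3)
    linarith
  -- the per-`k` identity (`log γ₀ = 1/(rη)`)
  have hrne : r ≠ 0 := hr.ne'
  set S₁ : ℝ := ∑ k ∈ Finset.range K, b (k + 1) *
    (g * ((1 - κ) / 2 * (Real.log ((k + 1 : ℕ) : ℝ) - Real.log (2 * π)) + 5 / T₀ ^ 2) +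
      (1 + κ) * g / T₀ ^ 2 + (1 + κ) * Mst * 90 * (1 / t₀ ^ 2 + 1 / t₀) / r) with hS₁
  clear_value S₁
  set S₂ : ℝ := ∑ k ∈ Finset.range K, b (k + 1) *
    ((1 + κ) * Mst / T₀ ^ 2 + (1 + κ) * m * (π / (σ₀ - 1 / 2)) / (2 * π * (σ₀ - 1 / 2) * r) +
      (1 + κ) * Mst * (3 * ((154 + 30 * (Real.log ((k + 1 : ℕ) : ℝ) + 1)) * (1 / t₀ ^ 2 + 1 / t₀) +
        30 * (Real.log t₀ / t₀ ^ 2 + (Real.log t₀ + 1) / t₀)))) with hS₂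
  clear_value S₂
  set S₃ : ℝ := ∑ k ∈ Finset.range K, b (k + 1) * ((1 + κ) * m * (2 / T₀ ^ 2 +
    (π / (σ₀ - 1 / 2) * Real.log ((k + 1 : ℕ) : ℝ) +
      (π / (σ₀ - 1 / 2) * (12 + Real.log 2) + (4 / (σ₀ - 1 / 2) ^ 2 + 8))) / (2 * π * (σ₀ - 1 / 2)))) with hS₃
  clear_value S₃
  set Asum : ℝ := ∑ k ∈ Finset.range K, b (k + 1) with hAsum
  clear_value Asum
  have hsum : ∑ k ∈ Finset.range K, b (k + 1) *
      (η * fordSmoothW0 θ * ((1 - κ) / 2 * (Real.log ((k + 1 : ℕ) : ℝ) + Real.log γ₀) -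
          (1 - κ) / 2 * Real.log (2 * π) + 5 / T₀ ^ 2) +
        (1 + κ) * (η * fordSmoothW0 θ + Mst * η ^ 2) / T₀ ^ 2 +
        (1 + κ) * (m * η ^ 3) * (2 / T₀ ^ 2 +
          (π / (σ₀ - 1 / 2) * (Real.log ((k + 1 : ℕ) : ℝ) + Real.log γ₀) +
            (π / (σ₀ - 1 / 2) * (12 + Real.log 2) + (4 / (σ₀ - 1 / 2) ^ 2 + 8))) / (2 * π * (σ₀ - 1 / 2))) +
        (1 + κ) * Mst * η ^ 2 * (3 * ((154 + 30 * (Real.log ((k + 1 : ℕ) : ℝ) + Real.log γ₀ + 1)) *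
          (1 / t₀ ^ 2 + 1 / t₀) + 30 * (Real.log t₀ / t₀ ^ 2 + (Real.log t₀ + 1) / t₀)))) =
      g * (1 - κ) / (2 * r) * Asum + η * S₁ + η ^ 2 * S₂ + η ^ 3 * S₃ := by
    rw [hS₁, hS₂, hS₃, hAsum, Finset.mul_sum, Finset.mul_sum, Finset.mul_sum, Finset.mul_sum,
      ← Finset.sum_add_distrib, ← Finset.sum_add_distrib, ← Finset.sum_add_distrib]
    refine Finset.sum_congr rfl fun k _ ↦ ?_
    rw [hlogγη, hg]
    have ha₀ne : σ₀ - 1 / 2 ≠ 0 := ha₀.ne'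
    have h2a : 2 * σ₀ - 1 ≠ 0 := by linarith
    have hT₀ne : T₀ ≠ 0 := by linarith
    have ht₀ne : t₀ ≠ 0 := by linarith
    field_simp
    ring
  rw [hsum] at HM
  clear hsum
  -- names for the remaining atoms
  set L₁ := mtyLaplace θ (1 / η) with hL₁
  clear_value L₁
  set L₂ := mtyLaplace θ (δ / η) with hL₂
  clear_value L₂
  set L₃ := mtyLaplace θ ((σ + δ - η) / η) with hL₃
  clear_value L₃
  set L₄ := mtyLaplace θ ((σ + δ - 1) / η) with hL₄
  clear_value L₄
  set Lw₁ := mtyLaplace θ (1 - w) with hLw₁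
  clear_value Lw₁
  set Lw₀ := mtyLaplace θ (-w) with hLw₀
  clear_value Lw₀
  set c₁₀ : ℝ := -((1 - κ) / 2) * Real.log π + (Complex.digamma ((3 / 2 : ℝ) : ℂ)).re / 2 -
    κ / 2 * (Complex.digamma ((((σ₀ + δ) / 2 + 1 : ℝ)) : ℂ)).re with hc₁₀
  clear_value c₁₀
  set tB₀ : ℝ := KadiriTail.tailBound 0 t₀ with htB₀
  clear_value tB₀
  set J₀ : ℝ := π / (σ₀ - 1 / 2) * (Real.log 3 + 12) + (4 / (σ₀ - 1 / 2) ^ 2 + 8) with hJ₀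
  clear_value J₀
  -- the main linear consequence of `HM` and the third-order bounds
  have hq : b 1 * Lw₁ - b 0 * Lw₀ ≤
      (η * (-(b 1) * g + κ * b 1 * g * (1 / δ + 1 / (σ₀ + δ - η₀)) - κ * b 0 * g / δ) +
        η ^ 3 * (b 1 * m + κ * b 1 * m * (1 / δ ^ 3 + 1 / (σ₀ + δ - η₀) ^ 3) + κ * b 0 * m / (σ₀ + δ - 1) ^ 3)) +
      b 0 * (η * g * c₁₀ + (1 + κ) * (m * η ^ 3) * (1 / σ₀ ^ 3 + J₀ / (2 * π * (σ₀ - 1 / 2))) +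
        (1 + κ) * Mst * η ^ 2 * (3 * tB₀)) +
      (g * (1 - κ) / (2 * r) * Asum + η * S₁ + η ^ 2 * S₂ + η ^ 3 * S₃) := by
    have hb1 := hb0 1
    have hb0' := hb0 0
    -- `HM` : b1 (Lw₁ + L₁ − κ(L₂ + L₃)) ≤ b0 (ηg c₁₀ + (Lw₀ − κL₄) + (1+κ)(mη³)(1/σ₀³+J₀/(2π a₀)) + (1+κ)Mst η²(3tB₀)) + (…)
    have t1 : -(b 1 * L₁) ≤ -(b 1) * (g * η - m * η ^ 3) := by
      have := mul_le_mul_of_nonneg_left hL1 hb1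
      linarith
    have t2 : κ * b 1 * L₂ ≤ κ * b 1 * (g * η / δ + m * η ^ 3 / δ ^ 3) :=
      mul_le_mul_of_nonneg_left (by linarith) (by positivity)
    have t3 : κ * b 1 * L₃ ≤ κ * b 1 * (g * η / (σ₀ + δ - η₀) + m * η ^ 3 / (σ₀ + δ - η₀) ^ 3) :=
      mul_le_mul_of_nonneg_left hL3' (by positivity)
    have t4 : -(κ * b 0 * L₄) ≤ -(κ * b 0 * (g * η / δ - m * η ^ 3 / (σ₀ + δ - 1) ^ 3)) := by
      have := mul_le_mul_of_nonneg_left hL4' (by positivity : 0 ≤ κ * b 0)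
      linarith
    have HM' := HM
    simp only [hg.symm] at HM'
    have step1 : b 1 * Lw₁ - b 0 * Lw₀ ≤ (-(b 1 * L₁) + κ * b 1 * L₂ + κ * b 1 * L₃ - κ * b 0 * L₄) +
        b 0 * (η * g * c₁₀ + (1 + κ) * (m * η ^ 3) * (1 / σ₀ ^ 3 + J₀ / (2 * π * (σ₀ - 1 / 2))) +
          (1 + κ) * Mst * η ^ 2 * (3 * tB₀)) +
        (g * (1 - κ) / (2 * r) * Asum + η * S₁ + η ^ 2 * S₂ + η ^ 3 * S₃) := by
      linear_combination HM'
    have step2' : (-(b 1 * L₁) + κ * b 1 * L₂ + κ * b 1 * L₃ - κ * b 0 * L₄) ≤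
        -(b 1) * (g * η - m * η ^ 3) + κ * b 1 * (g * η / δ + m * η ^ 3 / δ ^ 3) +
          κ * b 1 * (g * η / (σ₀ + δ - η₀) + m * η ^ 3 / (σ₀ + δ - η₀) ^ 3) -
          κ * b 0 * (g * η / δ - m * η ^ 3 / (σ₀ + δ - 1) ^ 3) := by linear_combination t1 + t2 + t3 + t4
    have e3 : -(b 1) * (g * η - m * η ^ 3) + κ * b 1 * (g * η / δ + m * η ^ 3 / δ ^ 3) +
          κ * b 1 * (g * η / (σ₀ + δ - η₀) + m * η ^ 3 / (σ₀ + δ - η₀) ^ 3) -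
          κ * b 0 * (g * η / δ - m * η ^ 3 / (σ₀ + δ - 1) ^ 3) =
        η * (-(b 1) * g + κ * b 1 * g * (1 / δ + 1 / (σ₀ + δ - η₀)) - κ * b 0 * g / δ) +
        η ^ 3 * (b 1 * m + κ * b 1 * m * (1 / δ ^ 3 + 1 / (σ₀ + δ - η₀) ^ 3) + κ * b 0 * m / (σ₀ + δ - 1) ^ 3) := by
      ring
    have step2 := step2'.trans_eq e3
    linear_combination step1 + step2
  clear HM
  -- the Lipschitz step
  have hKdiff : (b 1 * mtyLaplace θ (1 - r / R) - b 0 * mtyLaplace θ (-(r / R))) - (b 1 * Lw₁ - b 0 * Lw₀) ≤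
      η * (lam0 * (r ^ 2 * Real.log ((K : ℝ) + 1) / R)) := by
    have h1 := kadiriK_sub_le hθ hθ' (b₀ := b 0) (b₁ := b 1) (hb0 0) (hb0 1) w (r / R)
    have h2 : b 1 * mtyLaplaceMoment θ (1 - r / R) - b 0 * mtyLaplaceMoment θ (-w) ≤ lam0 := by
      have := mtyLaplaceMoment_antitone hθ hθ' (show -w ≤ -w₀ by linarith)
      have := mul_le_mul_of_nonneg_left this (hb0 0)
      linarith
    have h3 : (r / R - w) * (b 1 * mtyLaplaceMoment θ (1 - r / R) - b 0 * mtyLaplaceMoment θ (-w)) ≤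
        (r / R - w) * lam0 := mul_le_mul_of_nonneg_left h2 (by linarith)
    have h4 : (r / R - w) * lam0 ≤ η * (r ^ 2 * Real.log ((K : ℝ) + 1) / R) * lam0 :=
      mul_le_mul_of_nonneg_right hrRw hlam0
    rw [hLw₁, hLw₀]
    linarith [h1, h3, h4]
  -- signs of the higher coefficients, and `η ≤ η₀`
  have hlog1 : ∀ k : ℕ, 0 ≤ Real.log ((k + 1 : ℕ) : ℝ) := fun k ↦
    Real.log_nonneg (by norm_cast; omega)
  have hlogt₀ : 0 ≤ Real.log t₀ := Real.log_nonneg (by linarith)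
  have htB₀0 : 0 ≤ tB₀ := by rw [htB₀]; exact KadiriTail.tailBound_nonneg le_rfl (by linarith)
  have hJ₀0 : 0 ≤ J₀ := by
    have : 0 ≤ Real.log 3 := Real.log_nonneg (by norm_num)
    rw [hJ₀]; positivity
  have hS₂0 : 0 ≤ S₂ := by
    rw [hS₂]
    refine Finset.sum_nonneg fun k _ ↦ mul_nonneg (hb0 _) ?_
    have := hlog1 k
    positivity
  have hS₃0 : 0 ≤ S₃ := by
    rw [hS₃]
    refine Finset.sum_nonneg fun k _ ↦ mul_nonneg (hb0 _) ?_
    have := hlog1 k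
    have : 0 ≤ Real.log 2 := Real.log_nonneg (by norm_num)
    positivity
  set q₁ : ℝ := b 0 * ((1 + κ) * Mst * (3 * tB₀)) + S₂ with hq₁
  clear_value q₁
  set q₂ : ℝ := (b 1 * m + κ * b 1 * m * (1 / δ ^ 3 + 1 / (σ₀ + δ - η₀) ^ 3) + κ * b 0 * m / (σ₀ + δ - 1) ^ 3 +
    b 0 * ((1 + κ) * m * (1 / σ₀ ^ 3 + J₀ / (2 * π * (σ₀ - 1 / 2))))) + S₃ with hq₂
  clear_value q₂
  have hq₁0 : 0 ≤ q₁ := by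
    rw [hq₁]
    refine add_nonneg (mul_nonneg (hb0 0) (mul_nonneg (mul_nonneg (by linarith) hMst0) (by linarith))) hS₂0
  have hq₂0 : 0 ≤ q₂ := by
    rw [hq₂]
    have hb1 := hb0 1
    have hb0' := hb0 0
    have h1 : 0 ≤ 1 / δ ^ 3 + 1 / (σ₀ + δ - η₀) ^ 3 := by positivity
    have h2 : 0 ≤ 1 / σ₀ ^ 3 + J₀ / (2 * π * (σ₀ - 1 / 2)) :=
      add_nonneg (by positivity) (div_nonneg hJ₀0 (by positivity))
    have h3 : 0 ≤ κ * b 0 * m / (σ₀ + δ - 1) ^ 3 := div_nonneg (by positivity) (pow_nonneg hden₄.le 3)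
    have : 0 ≤ b 1 * m + κ * b 1 * m * (1 / δ ^ 3 + 1 / (σ₀ + δ - η₀) ^ 3) + κ * b 0 * m / (σ₀ + δ - 1) ^ 3 +
        b 0 * ((1 + κ) * m * (1 / σ₀ ^ 3 + J₀ / (2 * π * (σ₀ - 1 / 2)))) := by positivity
    linarith
  have hpow2 : η ^ 2 * q₁ ≤ η * η₀ * q₁ := mul_le_mul_of_nonneg_right hηsq hq₁0
  have hpow3 : η ^ 3 * q₂ ≤ η * η₀ ^ 2 * q₂ := mul_le_mul_of_nonneg_right hηcube hq₂0
  -- the coefficients of the statement are the ones assembled here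
  have hQ0 : coeffQ0 θ K b r δ κ σ₀ η₀ T₀ t₀ Mst =
      (-(b 1) * g + κ * b 1 * g * (1 / δ + 1 / (σ₀ + δ - η₀)) - κ * b 0 * g / δ + b 0 * g * c₁₀) + S₁ := by
    rw [hS₁, hc₁₀, hg]; rfl
  have hQ1 : coeffQ1 K b r κ σ₀ T₀ t₀ Mst m = q₁ := by rw [hq₁, htB₀, hS₂]; rfl
  have hQ2 : coeffQ2 K b δ κ σ₀ η₀ T₀ m = q₂ := by rw [hq₂, hJ₀, hS₃]; rfl
  rw [hQ0, hQ1, hQ2] at hN1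
  clear hQ0 hQ1 hQ2
  -- conclude
  have hfin := mul_nonpos_of_nonneg_of_nonpos hηpos.le hN1
  have hq₁η : η ^ 2 * q₁ = η ^ 2 * (b 0 * ((1 + κ) * Mst * (3 * tB₀)) + S₂) := by rw [hq₁]
  have hq₂η : η ^ 3 * q₂ = η ^ 3 * ((b 1 * m + κ * b 1 * m * (1 / δ ^ 3 + 1 / (σ₀ + δ - η₀) ^ 3) +
      κ * b 0 * m / (σ₀ + δ - 1) ^ 3 + b 0 * ((1 + κ) * m * (1 / σ₀ ^ 3 + J₀ / (2 * π * (σ₀ - 1 / 2))))) + S₃) := by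
    rw [hq₂]
  have hA1 : b 1 * Lw₁ - b 0 * Lw₀ ≤
      η * (-(b 1) * g + κ * b 1 * g * (1 / δ + 1 / (σ₀ + δ - η₀)) - κ * b 0 * g / δ) + η * (b 0 * g * c₁₀) +
        η * S₁ + g * (1 - κ) / (2 * r) * Asum + η ^ 2 * q₁ + η ^ 3 * q₂ := by
    rw [hq₁η, hq₂η]; linear_combination hq
  have hA2 : b 1 * Lw₁ - b 0 * Lw₀ ≤
      g * (1 - κ) / (2 * r) * Asum - η * (lam0 * (r ^ 2 * Real.log ((K : ℝ) + 1) / R)) := by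
    linear_combination hA1 + hpow2 + hpow3 + hfin
  have hA3 : b 1 * mtyLaplace θ (1 - r / R) - b 0 * mtyLaplace θ (-(r / R)) ≤
      g * (1 - κ) / (2 * r) * Asum := by linear_combination hA2 + hKdiff
  have hA4 : g * (1 - κ) * Asum / (2 * r) = g * (1 - κ) / (2 * r) * Asum := by ring
  linarith [hA3, hA4, hN2]

/-! ## Part C: the inputs of the master inequality from the region `R` and the verification of RH -/

/-- The zeros near the heights `kγ₀` lie in `1 − σ ≤ β ≤ σ` (`σ = 1 − 1/(R log(Kγ₀ + t₀))`), given
the classical region with constant `R` at every height `|t| ≥ 2` and the Riemann hypothesis up to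
a height `H ≥ t₀` (reflect `ρ ↦ 1 − ρ̄` for the lower bound). [cite: Kadiri2005, §2.3] -/
theorem near_zeros {R t₀ H γ₀ σ : ℝ} {K : ℕ} (hR : 0 < R) (ht₀ : 4 ≤ t₀) (hH : t₀ ≤ H) (hγ₀ : 0 ≤ γ₀)
    (hσ : σ = 1 - 1 / (R * Real.log (K * γ₀ + t₀))) (hσhalf : 1 / 2 ≤ σ)
    (hReg : HasOpenClassicalZeroFreeRegion R)
    (hRH : ∀ s : ℂ, riemannZeta s = 0 → 0 < s.re → s.re < 1 → |s.im| ≤ H → s.re = 1 / 2) :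
    ∀ k ≤ K, ∀ ρ : NicolasJExplicit.Zeros, |(ρ : ℂ).im - (k : ℝ) * γ₀| < t₀ →
      1 - σ ≤ (ρ : ℂ).re ∧ (ρ : ℂ).re ≤ σ := by
  intro k hk ρ hρ
  have hmem := ρ.2
  have hz := ZetaZeros.riemannZetaNontrivialZeros.zeta_eq_zero hmem
  have hre0 := ZetaZeros.riemannZetaNontrivialZeros.re_pos hmem
  have hre1 := ZetaZeros.riemannZetaNontrivialZeros.re_lt_one hmem
  rcases le_or_gt |(ρ : ℂ).im| H with hle | hgt
  · have := hRH _ hz hre0 hre1 hle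
    constructor <;> linarith
  · -- `|γ| ≤ Kγ₀ + t₀`, so `1 − 1/(R log|γ|) ≤ σ`
    have hkK : (k : ℝ) * γ₀ ≤ K * γ₀ := mul_le_mul_of_nonneg_right (by exact_mod_cast hk) hγ₀
    have habs : |(ρ : ℂ).im| ≤ K * γ₀ + t₀ := by
      have := abs_sub_abs_le_abs_sub (ρ : ℂ).im ((k : ℝ) * γ₀)
      rw [abs_of_nonneg (by positivity : (0 : ℝ) ≤ (k : ℝ) * γ₀)] at this
      linarith
    have h2 : 2 ≤ |(ρ : ℂ).im| := by linarith
    have hlog0 : 0 < Real.log |(ρ : ℂ).im| := Real.log_pos (by linarith)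
    have hlogle : Real.log |(ρ : ℂ).im| ≤ Real.log (K * γ₀ + t₀) := Real.log_le_log (by linarith) habs
    have hmono : 1 - 1 / (R * Real.log |(ρ : ℂ).im|) ≤ σ := by
      rw [hσ]
      have := one_div_le_one_div_of_le (by positivity) (mul_le_mul_of_nonneg_left hlogle hR.le)
      linarith
    constructor
    · -- the reflected zero `1 − ρ̄`
      have hmem' := ZetaZeros.riemannZetaNontrivialZeros.one_sub_conj_mem hmem
      have hz' := ZetaZeros.riemannZetaNontrivialZeros.zeta_eq_zero hmem'
      have e : (1 - (starRingEnd ℂ) (ρ : ℂ)) = ((1 - (ρ : ℂ).re : ℝ) : ℂ) + (((ρ : ℂ).im : ℝ) : ℂ) * I := by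
        apply Complex.ext <;> simp
      rw [e] at hz'
      have := hReg.re_le (β := 1 - (ρ : ℂ).re) (γ := (ρ : ℂ).im) h2 hz'
      linarith
    · have e : (ρ : ℂ) = (((ρ : ℂ).re : ℝ) : ℂ) + (((ρ : ℂ).im : ℝ) : ℂ) * I := (Complex.re_add_im _).symm
      have hz'' : riemannZeta ((((ρ : ℂ).re : ℝ) : ℂ) + (((ρ : ℂ).im : ℝ) : ℂ) * I) = 0 := by rwa [← e]
      have := hReg.re_le (β := (ρ : ℂ).re) (γ := (ρ : ℂ).im) h2 hz''
      linarith

/-- `ζ(σ + ikγ₀) ≠ 0` for `k ≤ K` (`σ = 1 − 1/(R log(Kγ₀+t₀)) > 1/2`), from the region `R` and RH up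
to `H`. [cite: Kadiri2005, §2.3] -/
theorem zeta_ne_zero_line {R t₀ H γ₀ σ : ℝ} {K : ℕ} (hR : 0 < R) (ht₀ : 4 ≤ t₀) (hH : t₀ ≤ H)
    (hγ₀ : 0 ≤ γ₀) (hσ : σ = 1 - 1 / (R * Real.log (K * γ₀ + t₀)))
    (hσhalf : 1 / 2 < σ) (hReg : HasOpenClassicalZeroFreeRegion R)
    (hRH : ∀ s : ℂ, riemannZeta s = 0 → 0 < s.re → s.re < 1 → |s.im| ≤ H → s.re = 1 / 2) :
    ∀ k ≤ K, riemannZeta ((σ : ℂ) + (((k : ℝ) * γ₀ : ℝ) : ℂ) * I) ≠ 0 := by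
  intro k hk hz
  set s : ℂ := (σ : ℂ) + (((k : ℝ) * γ₀ : ℝ) : ℂ) * I with hs
  have hsre : s.re = σ := by simp [hs]
  have hsim : s.im = (k : ℝ) * γ₀ := by simp [hs]
  have hmem := ZetaZeros.riemannZetaNontrivialZeros.mem_of_re_pos hz (by rw [hsre]; linarith)
  have him := ZetaZeros.riemannZetaNontrivialZeros.im_ne_zero hmem
  rcases le_or_gt |s.im| H with hle | hgt
  · have := hRH s hz (by rw [hsre]; linarith) (ZetaZeros.riemannZetaNontrivialZeros.re_lt_one hmem) hle
    rw [hsre] at this; linarith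
  · have hkK : (k : ℝ) * γ₀ ≤ K * γ₀ := mul_le_mul_of_nonneg_right (by exact_mod_cast hk) hγ₀
    have habs : |s.im| = (k : ℝ) * γ₀ := by rw [hsim]; exact abs_of_nonneg (by positivity)
    have h2 : 2 ≤ |s.im| := by linarith
    have hlt : |s.im| < K * γ₀ + t₀ := by rw [habs]; linarith
    have hlog0 : 0 < Real.log |s.im| := Real.log_pos (by linarith)
    have hloglt : Real.log |s.im| < Real.log (K * γ₀ + t₀) := Real.log_lt_log (by linarith) hlt
    have := hReg.re_le (β := σ) (γ := s.im) h2 (by rwa [hsim])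
    have hstrict : 1 - 1 / (R * Real.log |s.im|) < σ := by
      rw [hσ]
      have := one_div_lt_one_div_of_lt (by positivity) (mul_lt_mul_of_pos_left hloglt hR)
      linarith
    linarith

set_option maxHeartbeats 1600000 in
/-- **The strip `1 − 1/(r log γ) ≤ β ≤ 1 − 1/(R log γ)`, `γ > T₀`, is free of zeros** under the
numerical conditions (N1), (N2) of `per_zero_contra`, Kadiri's side conditions on `κ, δ`, the
boundary-inequality criterion at `(σ₀, η₀)`, the classical region with constant `R` at all heights
`|t| ≥ 2`, and the Riemann hypothesis up to a height `H ≥ t₀`.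
[cite: MossinghoffTrudgian2015, (2.2) and §5; MossinghoffTrudgianYangRNT2024, §9] -/
theorem strip_empty (hθ : 0 < θ) (hθ' : θ < π / 2) {r R δ κ t₀ T₀ H Mst m lam0 σ₀ η₀ w₀ : ℝ} {K : ℕ}
    {b : ℕ → ℝ} (hb : IsNonnegTrigPoly K b) (hK : 1 ≤ K) (hr : 0 < r) (hR : 0 < R)
    (hδ : 0 ≤ δ) (hδ1 : δ < 1) (hκ0 : 0 ≤ κ) (hκ1 : κ ≤ 1) (hT₀ : 7 ≤ T₀) (ht₀ : 4 ≤ t₀)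
    (ht₀T : t₀ ≤ T₀) (hH : t₀ ≤ H)
    (hσ₀ : σ₀ ≤ 1 - 1 / (R * Real.log (K * T₀ + t₀))) (hη₀ : 1 / (r * Real.log T₀) ≤ η₀)
    (hw₀ : w₀ ≤ r * Real.log T₀ / (R * Real.log (K * T₀ + t₀)))
    (hσ₀half : 1 / 2 < σ₀) (hη₀half : η₀ < 1 / 2) (hδσ₀ : 2 * (1 - σ₀) ≤ δ) (hσ₀δ : 1 < σ₀ + δ)
    (hκΓ : κ * (σ₀ + 2 + δ) ≤ σ₀ + 2) (hA : κ * (2 * σ₀ - 1 + 2 * δ) ≤ 2 * σ₀ - 1)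
    (hSt : κ * (1 + 2 * δ) * (δ + δ ^ 2 + t₀ ^ 2) ≤ (2 * σ₀ - 1) * (t₀ ^ 2 - (1 - σ₀)))
    (hMst : mtyM θ (-(r / R)) ≤ Mst)
    (hm : ∀ u ∈ Icc 0 (mtyD1 θ), |mtyH1Deriv2 1 θ u| ≤ m)
    (hlam0 : 0 ≤ lam0)
    (hlam : b 1 * mtyLaplaceMoment θ (1 - r / R) - b 0 * mtyLaplaceMoment θ (-w₀) ≤ lam0)
    (hN₀ : 0 ≤ fordSmoothW0 θ * (2 * σ₀ - 1) - m * η₀ ^ 2 / (2 * σ₀ - 1))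
    (hquad : ∀ Y : ℝ, 0 ≤ Y →
      κ * (1 + Y) * ((fordSmoothW0 θ * δ + m * η₀ ^ 2 / δ) * ((2 * σ₀ - 1 + δ) ^ 2 + Y) +
          (fordSmoothW0 θ * (1 + δ) + m * η₀ ^ 2 / (2 * σ₀ - 1 + δ)) * (δ ^ 2 + Y)) ≤
        (fordSmoothW0 θ * (2 * σ₀ - 1) - m * η₀ ^ 2 / (2 * σ₀ - 1)) * ((δ ^ 2 + Y) * ((2 * σ₀ - 1 + δ) ^ 2 + Y)))
    (hReg : HasOpenClassicalZeroFreeRegion R)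
    (hRH : ∀ s : ℂ, riemannZeta s = 0 → 0 < s.re → s.re < 1 → |s.im| ≤ H → s.re = 1 / 2)
    (hN1 : coeffQ0 θ K b r δ κ σ₀ η₀ T₀ t₀ Mst + lam0 * (r ^ 2 * Real.log ((K : ℝ) + 1) / R) +
      coeffQ1 K b r κ σ₀ T₀ t₀ Mst m * η₀ + coeffQ2 K b δ κ σ₀ η₀ T₀ m * η₀ ^ 2 ≤ 0)
    (hN2 : fordSmoothW0 θ * (1 - κ) * (∑ k ∈ Finset.range K, b (k + 1)) / (2 * r) <
      b 1 * mtyLaplace θ (1 - r / R) - b 0 * mtyLaplace θ (-(r / R))) :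
    KadiriStripEmpty T₀ r R := by
  intro β γ hz hγT hβlow hβup
  have hKr : (1 : ℝ) ≤ K := by exact_mod_cast hK
  have hγ7 : 7 ≤ γ := by linarith
  have hlogT : 0 < Real.log T₀ := Real.log_pos (by linarith)
  have hlogγ : Real.log T₀ ≤ Real.log γ := Real.log_le_log (by linarith) hγT.le
  have hlogγ0 : 0 < Real.log γ := hlogT.trans_le hlogγ
  -- `r log γ > 2`, so `β > 1/2`
  have hrlog : 2 < r * Real.log T₀ := by
    by_contra h
    push Not at h
    have : 1 / 2 ≤ 1 / (r * Real.log T₀) := by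
      rw [div_le_div_iff₀ (by norm_num) (by positivity)]; linarith
    linarith
  have hrlogγ : 2 < r * Real.log γ := by nlinarith
  have hβhalf : 1 / 2 < β := by
    have : 1 / (r * Real.log γ) < 1 / 2 := by
      rw [div_lt_div_iff₀ (by positivity) (by norm_num)]; linarith
    linarith
  have hβ1 : β < 1 := by
    have : 0 < 1 / (R * Real.log γ) := by positivity
    linarith
  -- the zero as an element of `Zeros`
  have him : ((β : ℂ) + (γ : ℂ) * I).im = γ := by simp
  have hre : ((β : ℂ) + (γ : ℂ) * I).re = β := by simp
  have hmem := ZetaZeros.riemannZetaNontrivialZeros.mem_of_re_pos hz (by rw [hre]; linarith)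
  -- heights up to `H` are excluded by RH
  rcases le_or_gt γ H with hle | hgt
  · have := hRH _ hz (by rw [hre]; linarith) (by rw [hre]; exact hβ1) (by rw [him, abs_of_nonneg (by linarith)]; exact hle)
    rw [hre] at this; linarith
  -- the parameters at this height
  set η : ℝ := 1 / (r * Real.log γ) with hη
  set σ : ℝ := 1 - 1 / (R * Real.log (K * γ + t₀)) with hσ
  have hηpos : 0 < η := by positivity
  have hηη₀ : η ≤ η₀ := by
    rw [hη]; exact le_trans (one_div_le_one_div_of_le (by positivity) (by nlinarith)) hη₀
  have hlogKT : 0 < Real.log (K * T₀ + t₀) := Real.log_pos (by nlinarith)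
  have hlogKγ : Real.log (K * T₀ + t₀) ≤ Real.log (K * γ + t₀) :=
    Real.log_le_log (by nlinarith) (by nlinarith)
  have hσ₀σ : σ₀ ≤ σ := by
    rw [hσ]
    have := one_div_le_one_div_of_le (by positivity) (mul_le_mul_of_nonneg_left hlogKγ hR.le)
    linarith
  have hlogKγ0 : 0 < Real.log (K * γ + t₀) := hlogKT.trans_le hlogKγ
  have hσ1 : σ < 1 := by
    have : 0 < 1 / (R * Real.log (K * γ + t₀)) := by positivity
    rw [hσ]; linarith
  have hσhalf : 1 / 2 < σ := by linarith
  -- `β ≤ σ`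
  have hβσ : β ≤ σ := by
    have hlogle : Real.log γ ≤ Real.log (K * γ + t₀) := Real.log_le_log (by linarith) (by nlinarith)
    have := one_div_le_one_div_of_le (by positivity) (mul_le_mul_of_nonneg_left hlogle hR.le)
    rw [hσ]; linarith
  -- the inputs of the master inequality
  have hnear := near_zeros (K := K) hR ht₀ hH (by linarith) hσ hσhalf.le hReg hRH
  have hζ := zeta_ne_zero_line (K := K) hR ht₀ hH (by linarith) hσ hσhalf hReg hRH
  have hζ' : ∀ k ≤ K, riemannZeta (((σ + δ : ℝ) : ℂ) + (((k : ℝ) * γ : ℝ) : ℂ) * I) ≠ 0 := fun k _ ↦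
    riemannZeta_ne_zero_of_one_le_re (by simp; linarith)
  have hδpos : 0 < δ := by linarith
  have hB : ∀ y : ℝ, κ * ((fordLaplace (kadiriTest θ η) ((δ : ℂ) + y * I)).re +
        (fordLaplace (kadiriTest θ η) (((2 * σ - 1 + δ : ℝ) : ℂ) + y * I)).re) ≤
      (fordLaplace (kadiriTest θ η) (((0 : ℝ) : ℂ) + y * I)).re +
        (fordLaplace (kadiriTest θ η) (((2 * σ - 1 : ℝ) : ℂ) + y * I)).re :=
    KadiriBoundary.boundary_ineq hθ hθ' hηpos hηη₀ hσ₀half hσ₀σ hσ1.le hδpos hκ0 hm hN₀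
      (KadiriBoundary.rational_condition_of_quad hδpos hσ₀half hquad)
  -- the contradiction
  exact per_zero_contra hθ hθ' (ρ₀ := ⟨_, hmem⟩) hb hK hr hR hδ hδ1 hκ0 hκ1 hT₀ ht₀ ht₀T hγT.le hη hσ
    hσ₀ hη₀ hw₀ hσ₀half hη₀half hδσ₀ hσ₀δ hκΓ hA hSt hMst hm hlam0 hlam hζ hζ' hnear hB
    (by exact him) (by simp only; rw [hre]; exact hβlow) (by simp only; rw [hre]; exact hβσ) hN1 hN2

/-! ## Part D: glue for the iteration `R ↦ r` -/

/-- **Crude bound for `M(X) = ∫₀^{d₁} |h''(u)| e^{−Xu} du`**: `M(X) ≤ d₁ · m · e^{|X| d₁}` when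
`|h''| ≤ m` on `[0, d₁]`. [folklore] -/
theorem mtyM_le_crude (hθ : 0 < θ) (hθ' : θ < π / 2) {m : ℝ}
    (hm : ∀ u ∈ Icc 0 (mtyD1 θ), |mtyH1Deriv2 1 θ u| ≤ m) (X : ℝ) :
    mtyM θ X ≤ mtyD1 θ * (m * Real.exp (|X| * mtyD1 θ)) := by
  have hD := KadiriTest.mtyD1_pos hθ hθ'
  unfold mtyM
  have hle : ∀ u ∈ Icc 0 (mtyD1 θ), |mtyH1Deriv2 1 θ u| * Real.exp (-(X * u)) ≤ m * Real.exp (|X| * mtyD1 θ) := by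
    intro u hu
    have hm0 : 0 ≤ m := (abs_nonneg _).trans (hm u hu)
    refine mul_le_mul (hm u hu) (Real.exp_le_exp.2 ?_) (Real.exp_nonneg _) hm0
    have h1 : -(X * u) ≤ |X| * u := by
      have := neg_abs_le X; nlinarith [hu.1]
    have h2 : |X| * u ≤ |X| * mtyD1 θ := mul_le_mul_of_nonneg_left hu.2 (abs_nonneg X)
    linarith
  calc ∫ u in (0 : ℝ)..mtyD1 θ, |mtyH1Deriv2 1 θ u| * Real.exp (-(X * u))
      ≤ ∫ _ in (0 : ℝ)..mtyD1 θ, m * Real.exp (|X| * mtyD1 θ) := by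
        refine intervalIntegral.integral_mono_on hD.le ?_ (by simp) hle
        exact (((continuous_mtyH1Deriv2 1 θ).abs).mul (by fun_prop)).intervalIntegrable _ _
    _ = mtyD1 θ * (m * Real.exp (|X| * mtyD1 θ)) := by
        rw [intervalIntegral.integral_const, smul_eq_mul, sub_zero]

/-- **A bound for `|h''|` on `[0, d₁]`** (sharper than the plain triangle inequality): writing
`x = u tan θ ∈ [0, 2θ]`, the bracket of `mtyH1Deriv2` is `sin x · c_s + cos x · c_c(x)` with
`c_s = sec²θ + tan θ cos 2θ/sin 2θ − 2 tan θ cos θ/sin θ` constant and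
`c_c(x) = tan θ − (θ − x/2)sec²θ` affine, whence
`|h''(u)| ≤ tan θ sec²θ (|c_s| + max(|tan θ − θ sec²θ|, |tan θ|))` (`≈ 72.6` at MTY's `θ`,
against the true maximum `|h''(0)| ≈ 50.8`). [cite: MossinghoffTrudgianYangRNT2024, (9.2)] -/
theorem abs_mtyH1Deriv2_le (hθ : 0 < θ) (hθ' : θ < π / 2) {u : ℝ} (hu0 : 0 ≤ u) (hu1 : u ≤ mtyD1 θ) :
    |mtyH1Deriv2 1 θ u| ≤ Real.tan θ / Real.cos θ ^ 2 *
      (|1 / Real.cos θ ^ 2 + Real.tan θ * Real.cos (2 * θ) / Real.sin (2 * θ) -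
          2 * Real.tan θ * Real.cos θ / Real.sin θ| +
        max |Real.tan θ - θ / Real.cos θ ^ 2| |Real.tan θ|) := by
  have hθπ : θ < π := by linarith [Real.pi_pos]
  have hcos : 0 < Real.cos θ := Real.cos_pos_of_mem_Ioo ⟨by linarith, hθ'⟩
  have hsin : 0 < Real.sin θ := Real.sin_pos_of_pos_of_lt_pi hθ hθπ
  have htan : 0 < Real.tan θ := by rw [Real.tan_eq_sin_div_cos]; positivity
  have hsin2 : 0 < Real.sin (2 * θ) := Real.sin_pos_of_pos_of_lt_pi (by linarith) (by linarith)
  set x : ℝ := u * Real.tan θ with hx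
  have hx0 : 0 ≤ x := by positivity
  have hx1 : x ≤ 2 * θ := by
    have hd : mtyD1 θ * Real.tan θ = 2 * θ := by
      unfold mtyD1
      rw [Real.cot_eq_cos_div_sin, Real.tan_eq_sin_div_cos]
      field_simp
    calc x = u * Real.tan θ := hx
      _ ≤ mtyD1 θ * Real.tan θ := mul_le_mul_of_nonneg_right hu1 htan.le
      _ = 2 * θ := hd
  unfold mtyH1Deriv2
  simp only [one_pow, one_mul]
  rw [← hx, abs_mul, abs_of_pos (by positivity : 0 < Real.tan θ / Real.cos θ ^ 2)]
  refine mul_le_mul_of_nonneg_left ?_ (by positivity)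
  -- the bracket as `sin x · c_s + cos x · c_c`
  set cs : ℝ := 1 / Real.cos θ ^ 2 + Real.tan θ * Real.cos (2 * θ) / Real.sin (2 * θ) -
    2 * Real.tan θ * Real.cos θ / Real.sin θ with hcs
  set cc : ℝ := Real.tan θ - (θ - x / 2) / Real.cos θ ^ 2 with hcc
  have e : 1 / Real.cos θ ^ 2 * (Real.sin x - (θ - x / 2) * Real.cos x) -
        Real.tan θ * Real.sin (2 * θ - x) / Real.sin (2 * θ) +
        2 * Real.tan θ * Real.sin (θ - x) / Real.sin θ = Real.sin x * cs + Real.cos x * cc := by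
    have hsin2' : Real.sin (2 * θ) ≠ 0 := hsin2.ne'
    have hsin2'' : Real.sin (θ * 2) ≠ 0 := by rwa [mul_comm] at hsin2'
    have hsin' : Real.sin θ ≠ 0 := hsin.ne'
    have hcos' : Real.cos θ ≠ 0 := hcos.ne'
    rw [hcs, hcc, Real.sin_sub, Real.sin_sub]
    field_simp
    ring
  rw [e]
  have h1 : |Real.sin x * cs + Real.cos x * cc| ≤ |cs| + |cc| := by
    refine (abs_add_le _ _).trans (add_le_add ?_ ?_)
    · rw [abs_mul]
      exact (mul_le_of_le_one_left (abs_nonneg _) (Real.abs_sin_le_one x))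
    · rw [abs_mul]
      exact (mul_le_of_le_one_left (abs_nonneg _) (Real.abs_cos_le_one x))
  have h2 : |cc| ≤ max |Real.tan θ - θ / Real.cos θ ^ 2| |Real.tan θ| := by
    refine abs_le_max_abs_abs ?_ ?_
    · rw [hcc]
      have : (θ - x / 2) / Real.cos θ ^ 2 ≤ θ / Real.cos θ ^ 2 :=
        div_le_div_of_nonneg_right (by linarith) (by positivity)
      linarith
    · rw [hcc]
      have : 0 ≤ (θ - x / 2) / Real.cos θ ^ 2 := div_nonneg (by linarith) (by positivity)
      linarith
  linarith

/-- **The Riemann hypothesis up to height `H = 3 000 175 332 800`** in the two-sided form used here,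
from the tree's fact `platt_trudgian_numerical_rh` (conjugate for negative ordinates).
[cite: MossinghoffTrudgianYangRNT2024, §9 (Platt–Trudgian 2021)] -/
theorem rh_up_to_of_numerical_rh (h : platt_trudgian_numerical_rh) :
    ∀ s : ℂ, riemannZeta s = 0 → 0 < s.re → s.re < 1 → |s.im| ≤ 3000175332800 → s.re = 1 / 2 := by
  intro s hs h0 _ hH
  have hmem := ZetaZeros.riemannZetaNontrivialZeros.mem_of_re_pos hs h0
  have him := ZetaZeros.riemannZetaNontrivialZeros.im_ne_zero hmem
  rcases lt_or_gt_of_ne him with hneg | hpos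
  · -- conjugate zero
    have hmem' := ZetaZeros.riemannZetaNontrivialZeros.conj_mem hmem
    have hs' := ZetaZeros.riemannZetaNontrivialZeros.zeta_eq_zero hmem'
    have := h _ hs' (by simp; linarith) (by simp; rw [abs_of_neg hneg] at hH; linarith)
    simpa using this
  · exact h s hs hpos (by rw [abs_of_pos hpos] at hH; exact hH)

/-- **The next round of the iteration**: if the region with constant `R` holds at every height
`|t| ≥ 2`, the strip `1 − 1/(r log γ) ≤ β ≤ 1 − 1/(R log γ)` is empty above `T₀`, RH holds up to
a height `H ≥ T₀`, and `r log 2 ≥ 2`, then the region with constant `r` holds at every height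
(no comparison between `r` and `R` is needed).
[cite: MossinghoffTrudgian2015, §5] -/
theorem hasOpenRegion_of_stripEmpty {r R T₀ H : ℝ} (hr : 0 < r) (hTH : T₀ ≤ H) (hr2 : 2 ≤ r * Real.log 2) (hReg : HasOpenClassicalZeroFreeRegion R)
    (hE : KadiriStripEmpty T₀ r R)
    (hRH : ∀ s : ℂ, riemannZeta s = 0 → 0 < s.re → s.re < 1 → |s.im| ≤ H → s.re = 1 / 2) :
    HasOpenClassicalZeroFreeRegion r := by
  intro σ t ht hσ hz
  have hlog2 : 0 < Real.log 2 := Real.log_pos (by norm_num)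
  have hlogt : Real.log 2 ≤ Real.log |t| := Real.log_le_log (by norm_num) ht
  have hlogt0 : 0 < Real.log |t| := hlog2.trans_le hlogt
  -- `σ > 1/2`
  have hσhalf : 1 / 2 < σ := by
    have h1 : 1 / (r * Real.log |t|) ≤ 1 / 2 := by
      rw [div_le_div_iff₀ (by positivity) (by norm_num)]; nlinarith
    linarith
  rcases le_or_gt 1 σ with h1σ | hσ1
  · exact riemannZeta_ne_zero_of_one_le_re (by simp; exact h1σ) hz
  have hmem := ZetaZeros.riemannZetaNontrivialZeros.mem_of_re_pos hz (by simp; linarith)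
  rcases le_or_gt |t| H with hle | hgt
  · have := hRH _ hz (by simp; linarith) (by simp; exact hσ1) (by simpa using hle)
    simp at this; linarith
  · -- a zero of height `> H ≥ T₀` in the region `R` but not below the `r`-curve: the empty strip
    have hup : σ ≤ 1 - 1 / (R * Real.log |t|) := hReg.re_le ht hz
    -- reduce to a positive ordinate
    have key : ∀ γ : ℝ, T₀ < γ → riemannZeta (σ + γ * I) = 0 → σ ≤ 1 - 1 / (R * Real.log γ) →
        1 - 1 / (r * Real.log γ) < σ → False := fun γ hγ hz' hup' hlow' ↦
      hE σ γ hz' hγ hlow'.le hup'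
    rcases le_or_gt 0 t with ht0 | ht0
    · rw [abs_of_nonneg ht0] at hgt hup hσ
      exact key t (by linarith) hz hup hσ
    · rw [abs_of_neg ht0] at hgt hup hσ
      have hmem' := ZetaZeros.riemannZetaNontrivialZeros.conj_mem hmem
      have hz' := ZetaZeros.riemannZetaNontrivialZeros.zeta_eq_zero hmem'
      have e : (starRingEnd ℂ) ((σ : ℂ) + (t : ℂ) * I) = (σ : ℂ) + ((-t : ℝ) : ℂ) * I := by
        apply Complex.ext <;> simp
      rw [e] at hz'
      exact key (-t) (by linarith) hz' hup hσ

/-- **The initial region**: from the tree's explicit (crude) zero-free region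
`1 − β ≥ 1/((4480 + 74172/log T) log|t|)` (`|t| ≥ T ≥ 5`) with `T = H`, and RH up to `H`, the
classical region holds at every height with any constant `R₀ ≥ 4480 + 74172/log H`.
[cite: MossinghoffTrudgianYangRNT2024, §9] -/
theorem hasOpenRegion_initial {H R₀ : ℝ} (hH : 5 ≤ H) (hR₀ : 4480 + 74172 / Real.log H ≤ R₀)
    (hRH : ∀ s : ℂ, riemannZeta s = 0 → 0 < s.re → s.re < 1 → |s.im| ≤ H → s.re = 1 / 2) :
    HasOpenClassicalZeroFreeRegion R₀ := by
  intro σ t ht hσ hz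
  have hlog2 : (0.6931471803 : ℝ) < Real.log 2 := Real.log_two_gt_d9
  have hlogt : Real.log 2 ≤ Real.log |t| := Real.log_le_log (by norm_num) ht
  have hlogt0 : 0 < Real.log |t| := by linarith
  have hlogH : 0 < Real.log H := Real.log_pos (by linarith)
  have h74 : 0 ≤ 74172 / Real.log H := by positivity
  have hR₀0 : 4480 ≤ R₀ := by linarith
  have hσhalf : 1 / 2 < σ := by
    have h1 : 1 / (R₀ * Real.log |t|) ≤ 1 / 2 := by
      rw [div_le_div_iff₀ (by positivity) (by norm_num)]; nlinarith
    linarith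
  rcases le_or_gt 1 σ with h1σ | hσ1
  · exact riemannZeta_ne_zero_of_one_le_re (by simp; exact h1σ) hz
  rcases le_or_gt |t| H with hle | hgt
  · have := hRH _ hz (by simp; linarith) (by simp; exact hσ1) (by simpa using hle)
    simp at this; linarith
  · have h := riemannZeta_one_sub_re_ge_explicit hH hgt.le hz
    have hmono : 1 / (R₀ * Real.log |t|) ≤ 1 / ((4480 + 74172 / Real.log H) * Real.log |t|) :=
      one_div_le_one_div_of_le (by positivity) (mul_le_mul_of_nonneg_right hR₀ hlogt0.le)
    linarith

end KadiriStrip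

end Literature.NumberTheory.LFunctions
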